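import Mathlib
import Literature.Analysis.FluidPDE.BoltzmannEquationProofs
import Literature.MathematicalPhysics.KineticTheory.BoltzmannSolutionsUkaiVelocity
import Literature.MathematicalPhysics.KineticTheory.HardSphereEulerProofs
import HarnessLib

/-!
# The hard-sphere entropy production of a Gaussian-dominated density is a convergent integral

`Literature.Analysis.FluidPDE.entropyProduction B f = ¼ ∫ B (f'f'_* - f f_*) log (f'f'_*/(f f_*))`
is a Bochner integral over `E × E × S^{d-1}` (junk value `0` when the integrand is not
integrable). This file shows that for the hard-sphere kernel `((v - v_*)·ω)₊` and a continuous,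
everywhere positive velocity density `f` with

* a Gaussian envelope `f ≤ K · M_{1,0,θ}` (`θ > 0`), and
* at most quadratic logarithm `|log f(v)| ≤ A + B |v|²`

(both hold for every finite Gaussian mixture bounded below by a Maxwellian, in particular for the
normalised cloud laws of `HardSphereEEP`), the entropy-production integrand is continuous and
integrable (`integrable_entropyProductionIntegrand`), so that `D(f)` is the genuine value of the
convergent integral (Rezakhanlou–Villani 2008, Ch. 1 §1.4: `D(f) < ∞` is implicit throughout; the
domination below is the standard one, using `|v'|² + |v_*'|² = |v|² + |v_*|²`).

The domination: `|((v-v_*)·ω)₊ (F' - F) log (F'/F)| ≤ C · [M(v)(1+|v|⁴)] · [M(v_*)(1+|v_*|⁴)]`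
with `F = f f_*`, `F' = f' f_*'`, `M = M_{1,0,θ}`, `C = 12 K² (4|A| + 2|B| + 1)`; the right-hand
side is integrable because Gaussian measures have moments of every order.
-/

namespace Literature.MathematicalPhysics.KineticTheory

open _root_.MeasureTheory Real ProbabilityTheory Metric
open scoped InnerProductSpace ENNReal
open Literature.Analysis.FluidPDE (localMaxwellian entropyProduction)

noncomputable section

variable {E : Type*} [NormedAddCommGroup E] [InnerProductSpace ℝ E]

/-! ## Pointwise facts -/

/-- `|((v - v_*)·ω)₊| ≤ |v| + |v_*|`. [folklore] -/
theorem abs_hardSphereKernel_le (p : E × E) (ω : sphere (0 : E) 1) :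
    |hardSphereKernel p ω| ≤ ‖p.1‖ + ‖p.2‖ := by
  unfold hardSphereKernel
  have h1 : |⟪p.1 - p.2, (ω : E)⟫_ℝ| ≤ ‖p.1‖ + ‖p.2‖ :=
    (abs_real_inner_le_norm _ _).trans (by
      rw [norm_eq_of_mem_sphere ω, mul_one]; exact norm_sub_le _ _)
  rw [abs_le] at h1 ⊢
  constructor
  · exact le_trans (by linarith [norm_nonneg p.1, norm_nonneg p.2]) (le_max_right _ _)
  · exact max_le h1.2 (by positivity)

/-- Energy conservation for Maxwellian weights: `M(v') M(v_*') = M(v) M(v_*)` for the centred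
local Maxwellian `M = M_{ρ,0,θ}`. [folklore] -/
theorem localMaxwellian_collide_mul (ρ θ : ℝ) (ω : sphere (0 : E) 1) (p : E × E) :
    localMaxwellian ρ θ 0 (collide ω p).1 * localMaxwellian ρ θ 0 (collide ω p).2 =
      localMaxwellian ρ θ 0 p.1 * localMaxwellian ρ θ 0 p.2 := by
  have h := norm_sq_collide_fst_add_norm_sq_collide_snd ω p
  unfold Literature.Analysis.FluidPDE.localMaxwellian
  simp only [sub_zero]
  have key : ∀ a b : E,
      ρ * (2 * π * θ) ^ (-(Module.finrank ℝ E : ℝ) / 2) * rexp (-‖a‖ ^ 2 / (2 * θ)) *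
        (ρ * (2 * π * θ) ^ (-(Module.finrank ℝ E : ℝ) / 2) * rexp (-‖b‖ ^ 2 / (2 * θ))) =
      ρ ^ 2 * ((2 * π * θ) ^ (-(Module.finrank ℝ E : ℝ) / 2)) ^ 2 *
        rexp (-(‖a‖ ^ 2 + ‖b‖ ^ 2) / (2 * θ)) := by
    intro a b
    rw [show -(‖a‖ ^ 2 + ‖b‖ ^ 2) / (2 * θ) = -‖a‖ ^ 2 / (2 * θ) + -‖b‖ ^ 2 / (2 * θ) by ring,
      Real.exp_add]
    ring
  rw [key, key, h]

/-- Elementary: `a ≤ 1 + a⁴` for `a ≥ 0`. [folklore] -/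
theorem le_one_add_pow_four {a : ℝ} (ha : 0 ≤ a) : a ≤ 1 + a ^ 4 := by
  rcases le_total a 1 with h | h
  · nlinarith [pow_nonneg ha 4]
  · have h3 : (1 : ℝ) ≤ a ^ 3 := one_le_pow₀ h
    nlinarith [mul_le_mul_of_nonneg_left h3 ha]

/-- Elementary: `a² ≤ 1 + a⁴`. [folklore] -/
theorem sq_le_one_add_pow_four (a : ℝ) : a ^ 2 ≤ 1 + a ^ 4 := by
  nlinarith [sq_nonneg (a ^ 2 - 1), sq_nonneg a]

/-- Elementary: `a³ ≤ 1 + a⁴` for `a ≥ 0`. [folklore] -/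
theorem pow_three_le_one_add_pow_four {a : ℝ} (ha : 0 ≤ a) : a ^ 3 ≤ 1 + a ^ 4 := by
  rcases le_total a 1 with h | h
  · nlinarith [pow_le_one₀ ha h (n := 3), pow_nonneg ha 4]
  · nlinarith [pow_nonneg ha 3, mul_le_mul_of_nonneg_left h (pow_nonneg ha 3)]

/-- The polynomial weight of the domination: `(a + b)(1 + a² + b²) ≤ 6 (1 + a⁴)(1 + b⁴)` for
`a, b ≥ 0`. [folklore] -/
theorem add_mul_one_add_sq_le {a b : ℝ} (ha : 0 ≤ a) (hb : 0 ≤ b) :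
    (a + b) * (1 + a ^ 2 + b ^ 2) ≤ 6 * ((1 + a ^ 4) * (1 + b ^ 4)) := by
  have h1 := le_one_add_pow_four ha
  have h2 := le_one_add_pow_four hb
  have h3 := pow_three_le_one_add_pow_four ha
  have h4 := pow_three_le_one_add_pow_four hb
  have h5 := sq_le_one_add_pow_four a
  have h6 := sq_le_one_add_pow_four b
  have hA : 0 ≤ 1 + a ^ 4 := by positivity
  have hB : 0 ≤ 1 + b ^ 4 := by positivity
  have e : (a + b) * (1 + a ^ 2 + b ^ 2) = a + a ^ 3 + a * b ^ 2 + (b + b ^ 3 + b * a ^ 2) := by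
    ring
  rw [e]
  have m1 : a ≤ (1 + a ^ 4) * (1 + b ^ 4) := h1.trans (le_mul_of_one_le_right hA (by nlinarith))
  have m2 : a ^ 3 ≤ (1 + a ^ 4) * (1 + b ^ 4) :=
    h3.trans (le_mul_of_one_le_right hA (by nlinarith))
  have m3 : a * b ^ 2 ≤ (1 + a ^ 4) * (1 + b ^ 4) := mul_le_mul h1 h6 (sq_nonneg b) hA
  have m4 : b ≤ (1 + a ^ 4) * (1 + b ^ 4) := h2.trans (le_mul_of_one_le_left hB (by nlinarith))
  have m5 : b ^ 3 ≤ (1 + a ^ 4) * (1 + b ^ 4) :=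
    h4.trans (le_mul_of_one_le_left hB (by nlinarith))
  have m6 : b * a ^ 2 ≤ (1 + a ^ 4) * (1 + b ^ 4) := by
    rw [mul_comm (1 + a ^ 4)]
    exact mul_le_mul h2 h5 (sq_nonneg a) hB
  linarith

variable [FiniteDimensional ℝ E] [MeasurableSpace E] [BorelSpace E]

/-! ## Gaussian moments -/

/-- Integrability against a local Maxwellian density is integrability against the Gaussian law
`gaussMeasure c θ` (`θ > 0`). [folklore] -/
theorem integrable_localMaxwellian_smul_iff_gaussMeasure {F : Type*} [NormedAddCommGroup F]
    [NormedSpace ℝ F] {θ : ℝ} (hθ : 0 < θ) (c : E) (g : E → F) :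
    Integrable (fun v => localMaxwellian 1 θ c v • g v) ↔ Integrable g (gaussMeasure c θ) := by
  rw [← withDensity_localMaxwellian_eq_gaussMeasure hθ c,
    integrable_withDensity_iff_integrable_smul'
      (continuous_localMaxwellian 1 θ c).measurable.ennreal_ofReal
      (Filter.Eventually.of_forall fun _ => ENNReal.ofReal_lt_top)]
  simp_rw [ENNReal.toReal_ofReal (localMaxwellian_nonneg zero_le_one hθ.le _ _)]

/-- Gaussian densities have finite fourth moments: `v ↦ M_{1,c,θ}(v) (1 + |v|⁴)` is integrable
(`θ > 0`). [folklore] -/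
theorem integrable_localMaxwellian_mul_one_add_norm_pow_four {θ : ℝ} (hθ : 0 < θ) (c : E) :
    Integrable (fun v => localMaxwellian 1 θ c v * (1 + ‖v‖ ^ 4)) :=
  (integrable_localMaxwellian_smul_iff_gaussMeasure hθ c (fun v => 1 + ‖v‖ ^ 4)).2
    ((integrable_const _).add ((IsGaussian.memLp_id _ 4 (by simp)).integrable_norm_pow
      (by norm_num)))

/-! ## The entropy-production integrand -/

/-- The integrand of `entropyProduction hardSphereKernel f` on `E × E × S^{d-1}`. An abbreviation
used only to keep statements readable; `entropyProduction hardSphereKernel f = ¼ ∫ epIntegrand f`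
definitionally (`entropyProduction_eq_integral_epIntegrand`). [folklore] -/
def epIntegrand (f : E → ℝ) (q : (E × E) × sphere (0 : E) 1) : ℝ :=
  hardSphereKernel q.1 q.2 *
    ((f (collide q.2 q.1).1 * f (collide q.2 q.1).2 - f q.1.1 * f q.1.2) *
      log (f (collide q.2 q.1).1 * f (collide q.2 q.1).2 / (f q.1.1 * f q.1.2)))

/-- `D(f) = ¼ ∫ epIntegrand f`. [folklore] -/
theorem entropyProduction_eq_integral_epIntegrand (f : E → ℝ) :
    entropyProduction hardSphereKernel f =
      4⁻¹ * ∫ q, epIntegrand f q ∂((volume.prod volume).prod sphereMeasure) :=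
  rfl

omit [FiniteDimensional ℝ E] [MeasurableSpace E] [BorelSpace E] in
/-- For continuous positive `f` the entropy-production integrand is continuous. [folklore] -/
theorem continuous_epIntegrand {f : E → ℝ} (hf : Continuous f) (hpos : ∀ v, 0 < f v) :
    Continuous (epIntegrand f) := by
  have hc := Literature.Analysis.FluidPDE.continuous_collide_uncurry (E := E)
  have h1 : Continuous fun q : (E × E) × sphere (0 : E) 1 => f (collide q.2 q.1).1 :=
    hf.comp (continuous_fst.comp hc)
  have h2 : Continuous fun q : (E × E) × sphere (0 : E) 1 => f (collide q.2 q.1).2 :=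
    hf.comp (continuous_snd.comp hc)
  have h3 : Continuous fun q : (E × E) × sphere (0 : E) 1 => f q.1.1 := by fun_prop
  have h4 : Continuous fun q : (E × E) × sphere (0 : E) 1 => f q.1.2 := by fun_prop
  unfold epIntegrand
  refine UkaiLanford.continuous_hardSphereKernel_uncurry.mul
    (((h1.mul h2).sub (h3.mul h4)).mul ?_)
  exact ((h1.mul h2).div (h3.mul h4) fun q => (mul_pos (hpos _) (hpos _)).ne').log
    fun q => (div_pos (mul_pos (hpos _) (hpos _)) (mul_pos (hpos _) (hpos _))).ne'

omit [FiniteDimensional ℝ E] [MeasurableSpace E] [BorelSpace E] in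
/-- **Domination of the entropy-production integrand.** For `0 < f ≤ K M_{1,0,θ}` with
`|log f| ≤ A + B|v|²`:
`|epIntegrand f ((v,v_*),ω)| ≤ 12 K² (4|A|+2|B|+1) · [M(v)(1+|v|⁴)] · [M(v_*)(1+|v_*|⁴)]`.
[folklore] -/
theorem abs_epIntegrand_le {f : E → ℝ} (hpos : ∀ v, 0 < f v) {K θ A B : ℝ} (hθ : 0 < θ)
    (hK : ∀ v, f v ≤ K * localMaxwellian 1 θ 0 v) (hlog : ∀ v, |log (f v)| ≤ A + B * ‖v‖ ^ 2)
    (q : (E × E) × sphere (0 : E) 1) :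
    |epIntegrand f q| ≤
      12 * K ^ 2 * (4 * |A| + 2 * |B| + 1) *
        ((localMaxwellian 1 θ 0 q.1.1 * (1 + ‖q.1.1‖ ^ 4)) *
          (localMaxwellian 1 θ 0 q.1.2 * (1 + ‖q.1.2‖ ^ 4))) := by
  obtain ⟨⟨v, w⟩, ω⟩ := q
  set c := collide ω (v, w) with hc
  set M : E → ℝ := fun x => localMaxwellian 1 θ 0 x with hM
  have hMpos : ∀ x, 0 < M x := fun x => localMaxwellian_pos one_pos hθ 0 x
  have hF : 0 < f v * f w := mul_pos (hpos v) (hpos w)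
  have hF' : 0 < f c.1 * f c.2 := mul_pos (hpos _) (hpos _)
  -- Gaussian envelopes of `F` and `F'`
  have hK0 : 0 ≤ K := ((mul_pos_iff_of_pos_right (hMpos v)).1 ((hpos v).trans_le (hK v))).le
  have hFle : f v * f w ≤ K ^ 2 * (M v * M w) := by
    calc f v * f w ≤ (K * M v) * (K * M w) :=
          mul_le_mul (hK v) (hK w) (hpos w).le (mul_nonneg hK0 (hMpos v).le)
      _ = K ^ 2 * (M v * M w) := by ring
  have hF'le : f c.1 * f c.2 ≤ K ^ 2 * (M v * M w) := by
    calc f c.1 * f c.2 ≤ (K * M c.1) * (K * M c.2) :=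
          mul_le_mul (hK _) (hK _) (hpos _).le (mul_nonneg hK0 (hMpos _).le)
      _ = K ^ 2 * (M c.1 * M c.2) := by ring
      _ = K ^ 2 * (M v * M w) := by rw [hM, hc, localMaxwellian_collide_mul 1 θ ω (v, w)]
  -- logarithms
  have he := norm_sq_collide_fst_add_norm_sq_collide_snd ω (v, w)
  simp only at he
  have hlogF : |log (f v * f w)| ≤ 2 * |A| + |B| * (‖v‖ ^ 2 + ‖w‖ ^ 2) := by
    rw [Real.log_mul (hpos v).ne' (hpos w).ne']
    refine (abs_add_le _ _).trans ?_
    have h1 := (hlog v).trans (add_le_add (le_abs_self A)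
      (mul_le_mul_of_nonneg_right (le_abs_self B) (sq_nonneg _)))
    have h2 := (hlog w).trans (add_le_add (le_abs_self A)
      (mul_le_mul_of_nonneg_right (le_abs_self B) (sq_nonneg _)))
    nlinarith
  have hlogF' : |log (f c.1 * f c.2)| ≤ 2 * |A| + |B| * (‖v‖ ^ 2 + ‖w‖ ^ 2) := by
    rw [Real.log_mul (hpos _).ne' (hpos _).ne', ← he]
    refine (abs_add_le _ _).trans ?_
    have h1 := (hlog c.1).trans (add_le_add (le_abs_self A)
      (mul_le_mul_of_nonneg_right (le_abs_self B) (sq_nonneg _)))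
    have h2 := (hlog c.2).trans (add_le_add (le_abs_self A)
      (mul_le_mul_of_nonneg_right (le_abs_self B) (sq_nonneg _)))
    nlinarith
  have hlogR : |log (f c.1 * f c.2 / (f v * f w))| ≤
      4 * |A| + 2 * |B| * (‖v‖ ^ 2 + ‖w‖ ^ 2) := by
    rw [Real.log_div hF'.ne' hF.ne']
    refine (abs_sub _ _).trans ?_
    linarith
  -- assemble
  have hkern := abs_hardSphereKernel_le (v, w) ω
  simp only at hkern
  have hdiff : |f c.1 * f c.2 - f v * f w| ≤ 2 * K ^ 2 * (M v * M w) := by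
    rw [abs_le]; constructor <;> nlinarith
  have hpoly := add_mul_one_add_sq_le (norm_nonneg v) (norm_nonneg w)
  have hMM : 0 ≤ M v * M w := mul_nonneg (hMpos v).le (hMpos w).le
  unfold epIntegrand
  simp only
  rw [← hc, abs_mul, abs_mul]
  have hL0 : 0 ≤ 4 * |A| + 2 * |B| * (‖v‖ ^ 2 + ‖w‖ ^ 2) := by positivity
  calc |hardSphereKernel (v, w) ω| * (|f c.1 * f c.2 - f v * f w| *
        |log (f c.1 * f c.2 / (f v * f w))|)
      ≤ (‖v‖ + ‖w‖) * ((2 * K ^ 2 * (M v * M w)) *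
          (4 * |A| + 2 * |B| * (‖v‖ ^ 2 + ‖w‖ ^ 2))) := by
        gcongr
    _ = 2 * K ^ 2 * (M v * M w) * ((‖v‖ + ‖w‖) * (4 * |A| + 2 * |B| * (‖v‖ ^ 2 + ‖w‖ ^ 2))) := by
        ring
    _ ≤ 2 * K ^ 2 * (M v * M w) *
          ((4 * |A| + 2 * |B| + 1) * ((‖v‖ + ‖w‖) * (1 + ‖v‖ ^ 2 + ‖w‖ ^ 2))) := by
        refine mul_le_mul_of_nonneg_left ?_ (mul_nonneg (by positivity) hMM)
        have hs : 0 ≤ ‖v‖ + ‖w‖ := by positivity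
        have hq : 0 ≤ ‖v‖ ^ 2 + ‖w‖ ^ 2 := by positivity
        nlinarith [mul_nonneg hs hq, mul_nonneg hs (abs_nonneg B),
          mul_nonneg (mul_nonneg hs hq) (abs_nonneg A), mul_nonneg (mul_nonneg hs hq) (abs_nonneg B),
          mul_nonneg hs (abs_nonneg A)]
    _ ≤ 2 * K ^ 2 * (M v * M w) *
          ((4 * |A| + 2 * |B| + 1) * (6 * ((1 + ‖v‖ ^ 4) * (1 + ‖w‖ ^ 4)))) :=
        mul_le_mul_of_nonneg_left (mul_le_mul_of_nonneg_left hpoly (by positivity))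
          (mul_nonneg (by positivity) hMM)
    _ = 12 * K ^ 2 * (4 * |A| + 2 * |B| + 1) * ((M v * (1 + ‖v‖ ^ 4)) * (M w * (1 + ‖w‖ ^ 4))) := by
        ring

/-- **The entropy-production integrand of a Gaussian-dominated density is integrable** on
`E × E × S^{d-1}` against `(dv dv_*) dω`: for `f` continuous with `0 < f ≤ K M_{1,0,θ}` (`θ > 0`)
and `|log f(v)| ≤ A + B|v|²`. Consequently `D(f) = entropyProduction hardSphereKernel f` is the
value of a convergent integral (not a junk `0`). [folklore] -/
theorem integrable_epIntegrand {f : E → ℝ} (hf : Continuous f) (hpos : ∀ v, 0 < f v) {K θ A B : ℝ}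
    (hθ : 0 < θ) (hK : ∀ v, f v ≤ K * localMaxwellian 1 θ 0 v)
    (hlog : ∀ v, |log (f v)| ≤ A + B * ‖v‖ ^ 2) :
    Integrable (epIntegrand f) (((volume : Measure E).prod volume).prod sphereMeasure) := by
  haveI : IsFiniteMeasure (sphereMeasure (E := E)) := by
    unfold sphereMeasure; infer_instance
  set φ : E → ℝ := fun x => localMaxwellian 1 θ 0 x * (1 + ‖x‖ ^ 4) with hφ
  have hφi : Integrable φ := integrable_localMaxwellian_mul_one_add_norm_pow_four hθ 0
  have hG : Integrable (fun q : (E × E) × sphere (0 : E) 1 =>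
      (12 * K ^ 2 * (4 * |A| + 2 * |B| + 1) * (φ q.1.1 * φ q.1.2)) * (1 : ℝ))
      (((volume : Measure E).prod volume).prod sphereMeasure) :=
    ((hφi.mul_prod hφi).const_mul _).mul_prod (integrable_const (1 : ℝ))
  refine hG.mono' (continuous_epIntegrand hf hpos).aestronglyMeasurable
    (Filter.Eventually.of_forall fun q => ?_)
  rw [Real.norm_eq_abs, mul_one]
  exact abs_epIntegrand_le hpos hθ hK hlog q

end

end Literature.MathematicalPhysics.KineticTheory
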